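import Summits.Ventures.CertifiedArithmetic.LowPrec.SRCoupledBlock
import HarnessLib

/-!
# Stochastic rounding in low-precision formats LXIII — ONE RANDOM DRAW PER BLOCK (ii): the block-SUM
# error of the prefix-scan coupling is free of the block length — `E e = 0`, `|e| ≤ (1 − 2^{-N})·G₀`
# SURELY, `E e² ≤ G₀²/4` — by Abel summation over non-increasing gaps; a kernel-checked E2M1 block

HONEST FRAMING: certified error envelopes and provably optimal rounding/accumulation schemes for
low-precision formats under stated cost models; every table by two implementations; no hardware or
vendor claims.

Setting of file LXII (`LowPrec/SRCoupledBlock`): one draw `R < m` shared by a block, `Bᵢ(R) ∈ {0,1}` the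
rounding bit of element `i` (`sysUp`), `θᵢ = tᵢ/m`, prefix discrepancies `Dₖ` (`disc`) with
`∑_R Dₖ = 0`, `∑_R Dₖ² ≤ m/4`, `|Dₖ| ≤ 1 − 1/m`.
1. BLOCK-SUM ERROR `e(R) = ∑_{i<n} Gᵢ(Bᵢ(R) − θᵢ)` (`blockErr`; `Gᵢ` = gap of element `i`'s cell, so
   `e = ∑ rounded − ∑ exact`, `blockErr_eq_values`); `∑_R e(R) = 0` for ANY gaps (`sum_blockErr`).
2. ABEL FORM (`abel_identity`, `blockErr_eq_wsum`): `e(R) = ∑_{i<n} (Gᵢ − Gᵢ₊₁)·Dᵢ₊₁(R)` with `Gₙ := 0`.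
   With the elements taken in order of NON-INCREASING gap (under one block scale: non-increasing
   magnitude) the weights are `≥ 0` with total `G₀` (`gx_sub_nonneg`, `sum_gx_sub`), whence for EVERY
   draw `|e(R)| ≤ (1 − 1/m)·G₀` (`abs_blockErr_le`) and, by a weighted Jensen step (`wsum_sq_le`),
   `∑_R e(R)² ≤ m·G₀²/4` (`sum_blockErr_sq_le`) — both free of the block length `n`.  Baselines: `n`
   independent SRs give `E e² = ∑ Gᵢ²θᵢ(1−θᵢ)` (up to `n·G₀²/4`) and errors filling
   `[−∑Gᵢθᵢ, ∑Gᵢ(1−θᵢ)]` (all-down / all-up outcomes; width `∑ Gᵢ`, growing with `n`);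
   round-to-nearest a deterministic bias up to `∑ Gᵢ/2`.
3. EQUAL GAPS (`blockErr_const`): `e = G·Dₙ` — the rounded block sum is ITSELF the `N`-bit stochastic
   rounding (same draw) of the exact block sum (the sequence case of [DoerrEtAl2006, Thm. 3]).
4. KERNEL WITNESS (`FP4`): E2M1 block `(11/2, 13/4, 5/2, 9/8)` — cells `[4,6], [3,4], [2,3], [1,3/2]`,
   gaps `(2,1,1,1/2)`, `θ = (3,1,2,1)/4`, `N = 2` (`blk_cells`): marginals `(3,1,2,1)` of `4` draws
   exactly (`coupled_marginals`), rounding patterns `(0,1,0,0), (1,0,0,1), (1,0,1,0), (1,0,1,0)`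
   (`coupled_patterns`), `e ∈ {−11/8, 1/8, 5/8, 5/8}`: mean `0`, `E e² = 43/64 < 1 = G₀²/4`,
   `|e| ≤ 11/8 < 3/2 = (1 − 1/4)·2` (`coupled_block_witness`); independent `SR₂` on the same block:
   `E e² = 79/64`, errors filling `[−19/8, 17/8]`; round-to-nearest: deterministic `5/8` or `−3/8`
   (`baselines_block`).
NOT CLAIMED: functionals other than the block sum — for `∑ ±Gᵢ(Bᵢ−θᵢ)` with mixed signs this coupling
can be WORSE than independent SR by a factor `n` (file LXIV: independent SR is minimax there); recursive
(data-dependent) accumulation; the order hypothesis is needed for the constants (any order keeps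
`E e = 0` and exact marginals).
Prior art: as file LXII — [DoerrEtAl2006, Thm. 1, Thm. 3] (all initial intervals, discrepancy `< 1`,
equal weights), [Madow1949], [Cox1987], [SureshEtAl2022, Thm. 2, 4, 5].  The gap-weighted sure bound
`(1 − 2^{-N})·G₀` and the second-moment law `G₀²/4` for floating-point blocks are new as far as searched
(FRESHNESS-SR K).
-/

namespace Summit.Ventures.CertifiedArithmetic.LowPrec.SR

open Finset

namespace Coupled

section Value

variable {K : Type*} [Field K] [LinearOrder K] [IsStrictOrderedRing K]


/-- **Block-sum error** under the shared draw: `e(R) = ∑_{i<n} Gᵢ·(Bᵢ(R) − θᵢ)`, `Gᵢ` the gap of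
element `i`'s cell. -/
def blockErr (m : ℕ) (t : ℕ → ℕ) (G : ℕ → K) (R n : ℕ) : K :=
  ∑ i ∈ range n, G i * ((sysUp m t R i : K) - (t i : K) / m)

/-- Reading of `blockErr`: with cell bottoms `dᵢ`, exact values `xᵢ = dᵢ + θᵢGᵢ` and rounded values
`yᵢ = dᵢ + BᵢGᵢ`, `∑ yᵢ − ∑ xᵢ = e(R)`. -/
theorem blockErr_eq_values (m : ℕ) (t : ℕ → ℕ) (d G : ℕ → K) (R n : ℕ) :
    ∑ i ∈ range n, (d i + (sysUp m t R i : K) * G i)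
      - ∑ i ∈ range n, (d i + (t i : K) / m * G i) = blockErr m t G R n := by
  rw [blockErr, ← sum_sub_distrib]
  exact sum_congr rfl fun i _ => by ring

/-- **Unbiased**: `∑_{R<m} e(R) = 0`. -/
theorem sum_blockErr {m : ℕ} (hm : 0 < m) (t : ℕ → ℕ) (G : ℕ → K) (n : ℕ) :
    ∑ R ∈ range m, blockErr m t G R n = 0 := by
  unfold blockErr
  rw [sum_comm]
  refine sum_eq_zero fun i _ => ?_
  rw [← mul_sum, sum_sub_distrib, ← Nat.cast_sum, sum_sysUp_marginal hm, sum_const, card_range,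
    nsmul_eq_mul]
  have hm' : (m : K) ≠ 0 := by exact_mod_cast hm.ne'
  field_simp
  ring

omit [LinearOrder K] [IsStrictOrderedRing K] in
/-- Discrete product rule (Abel summation with both boundary terms). -/
theorem abel_identity (G D : ℕ → K) (n : ℕ) :
    ∑ i ∈ range n, G i * (D (i + 1) - D i)
      = G n * D n - G 0 * D 0 - ∑ i ∈ range n, (G (i + 1) - G i) * D (i + 1) := by
  induction n with
  | zero => simp
  | succ n ih => rw [sum_range_succ, sum_range_succ, ih]; ring

/-- The block's gap profile extended by `0` past its last element. -/
def gx (G : ℕ → K) (n j : ℕ) : K := if j < n then G j else 0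

/-- **Abel form of the block error**: `e(R) = ∑_{i<n} (Gᵢ − Gᵢ₊₁)·Dᵢ₊₁(R)` with `Gₙ := 0` (`R < m`). -/
theorem blockErr_eq_wsum {m R : ℕ} (t : ℕ → ℕ) (hR : R < m) (G : ℕ → K) (n : ℕ) :
    blockErr m t G R n = ∑ i ∈ range n, (gx G n i - gx G n (i + 1)) * disc K m t R (i + 1) := by
  have hδ : ∀ i, (sysUp m t R i : K) - (t i : K) / m = disc K m t R (i + 1) - disc K m t R i := by
    intro i
    rw [← sum_sysUp_sub_eq_disc t hR (i + 1), ← sum_sysUp_sub_eq_disc t hR i, sum_range_succ]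
    ring
  have h1 : blockErr m t G R n
      = ∑ i ∈ range n, gx G n i * (disc K m t R (i + 1) - disc K m t R i) := by
    unfold blockErr
    exact sum_congr rfl fun i hi => by rw [hδ, gx, if_pos (mem_range.mp hi)]
  have hn : gx G n n = 0 := by simp [gx]
  rw [h1, abel_identity, hn, disc_zero t hR, zero_mul, mul_zero, sub_zero, zero_sub,
    ← sum_neg_distrib]
  exact sum_congr rfl fun i _ => by ring

/-- The Abel weights are nonnegative when the gaps are non-increasing along the block and
nonnegative. -/
theorem gx_sub_nonneg {G : ℕ → K} {n : ℕ} (hmono : ∀ i, i + 1 < n → G (i + 1) ≤ G i)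
    (hnn : ∀ i, 0 ≤ G i) (i : ℕ) (hi : i < n) : 0 ≤ gx G n i - gx G n (i + 1) := by
  unfold gx
  rw [if_pos hi]
  split_ifs with h
  · exact sub_nonneg.mpr (hmono i h)
  · simpa using hnn i

omit [LinearOrder K] [IsStrictOrderedRing K] in
/-- … and their total is the largest gap `G₀`. -/
theorem sum_gx_sub (G : ℕ → K) {n : ℕ} (hn : 0 < n) :
    ∑ i ∈ range n, (gx G n i - gx G n (i + 1)) = G 0 := by
  rw [sum_range_sub']
  simp [gx, hn]

/-- Weighted Jensen for squares: `(∑ aᵢDᵢ)² ≤ (∑ aᵢ)·∑ aᵢDᵢ²` for `aᵢ ≥ 0`. -/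
theorem wsum_sq_le {ι : Type*} (s : Finset ι) {a : ι → K} (D : ι → K) (ha : ∀ i ∈ s, 0 ≤ a i) :
    (∑ i ∈ s, a i * D i) ^ 2 ≤ (∑ i ∈ s, a i) * ∑ i ∈ s, a i * D i ^ 2 := by
  set A := ∑ i ∈ s, a i with hA_def
  set S := ∑ i ∈ s, a i * D i with hS_def
  set Q := ∑ i ∈ s, a i * D i ^ 2 with hQ_def
  have hA : 0 ≤ A := sum_nonneg ha
  have hexp : ∑ i ∈ s, a i * (A * D i - S) ^ 2 = A * (A * Q - S ^ 2) := by
    have : ∀ i ∈ s, a i * (A * D i - S) ^ 2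
        = A ^ 2 * (a i * D i ^ 2) - 2 * A * S * (a i * D i) + S ^ 2 * a i := fun i _ => by ring
    rw [sum_congr rfl this, sum_add_distrib, sum_sub_distrib, ← mul_sum, ← mul_sum, ← mul_sum]
    ring
  have hkey : 0 ≤ A * (A * Q - S ^ 2) :=
    hexp ▸ sum_nonneg fun i hi => mul_nonneg (ha i hi) (sq_nonneg _)
  rcases hA.eq_or_lt with hA0 | hApos
  · have ha0 : ∀ i ∈ s, a i = 0 := (sum_eq_zero_iff_of_nonneg ha).mp hA0.symm
    have hS : S = 0 := sum_eq_zero fun i hi => by rw [ha0 i hi, zero_mul]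
    rw [hS, ← hA0]
    simp
  · nlinarith [hkey, hApos]

/-- **SURE block bound.**  Gaps non-increasing along the block and nonnegative: for EVERY draw `R < m`,
`|e(R)| ≤ (1 − 1/m)·G₀` — free of the block length `n`
(independent SR: up to `max(∑Gᵢθᵢ, ∑Gᵢ(1−θᵢ)) ≥ ∑Gᵢ/2`). [new] -/
theorem abs_blockErr_le {m R : ℕ} (hm : 0 < m) (hR : R < m) (t : ℕ → ℕ) {G : ℕ → K} {n : ℕ}
    (hmono : ∀ i, i + 1 < n → G (i + 1) ≤ G i) (hnn : ∀ i, 0 ≤ G i) :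
    |blockErr m t G R n| ≤ (1 - 1 / (m : K)) * G 0 := by
  have hc : (0 : K) ≤ 1 - 1 / m := by
    rw [sub_nonneg, div_le_one (by exact_mod_cast hm)]
    exact_mod_cast Nat.succ_le_of_lt hm
  rcases Nat.eq_zero_or_pos n with rfl | hn
  · simpa [blockErr] using mul_nonneg hc (hnn 0)
  have hw := fun i (hi : i ∈ range n) => gx_sub_nonneg hmono hnn i (mem_range.mp hi)
  rw [blockErr_eq_wsum t hR G n]
  calc |∑ i ∈ range n, (gx G n i - gx G n (i + 1)) * disc K m t R (i + 1)|
      ≤ ∑ i ∈ range n, |(gx G n i - gx G n (i + 1)) * disc K m t R (i + 1)| :=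
        abs_sum_le_sum_abs _ _
    _ ≤ ∑ i ∈ range n, (gx G n i - gx G n (i + 1)) * (1 - 1 / (m : K)) := by
        refine sum_le_sum fun i hi => ?_
        rw [abs_mul, abs_of_nonneg (hw i hi)]
        exact mul_le_mul_of_nonneg_left (abs_disc_le hm hR t _) (hw i hi)
    _ = (1 - 1 / (m : K)) * G 0 := by rw [← sum_mul, sum_gx_sub G hn, mul_comm]

/-- **Mean-square block bound.**  Same hypotheses: `∑_{R<m} e(R)² ≤ m·G₀²/4`, i.e. `E e² ≤ G₀²/4`,
free of `n` (independent SR: `∑ᵢ Gᵢ²θᵢ(1−θᵢ)`, up to `n·G₀²/4`). [new] -/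
theorem sum_blockErr_sq_le {m : ℕ} (hm : 0 < m) (t : ℕ → ℕ) {G : ℕ → K} {n : ℕ}
    (hmono : ∀ i, i + 1 < n → G (i + 1) ≤ G i) (hnn : ∀ i, 0 ≤ G i) :
    ∑ R ∈ range m, (blockErr m t G R n) ^ 2 ≤ (m : K) * G 0 ^ 2 / 4 := by
  rcases Nat.eq_zero_or_pos n with rfl | hn
  · simp only [blockErr, sum_range_zero, zero_pow two_ne_zero, sum_const_zero]
    positivity
  have hw := fun i (hi : i ∈ range n) => gx_sub_nonneg hmono hnn i (mem_range.mp hi)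
  calc ∑ R ∈ range m, (blockErr m t G R n) ^ 2
      ≤ ∑ R ∈ range m, G 0 * ∑ i ∈ range n,
          (gx G n i - gx G n (i + 1)) * disc K m t R (i + 1) ^ 2 := by
        refine sum_le_sum fun R hR => ?_
        rw [blockErr_eq_wsum t (mem_range.mp hR) G n]
        have h := wsum_sq_le (range n) (fun i => disc K m t R (i + 1)) hw
        rwa [sum_gx_sub G hn] at h
    _ = G 0 * ∑ i ∈ range n,
          (gx G n i - gx G n (i + 1)) * ∑ R ∈ range m, disc K m t R (i + 1) ^ 2 := by
        rw [← mul_sum, sum_comm]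
        congr 1
        exact sum_congr rfl fun i _ => by rw [mul_sum]
    _ ≤ G 0 * ∑ i ∈ range n, (gx G n i - gx G n (i + 1)) * ((m : K) / 4) := by
        refine mul_le_mul_of_nonneg_left (sum_le_sum fun i hi => ?_) (hnn 0)
        exact mul_le_mul_of_nonneg_left (sum_disc_sq_le hm t _) (hw i hi)
    _ = (m : K) * G 0 ^ 2 / 4 := by rw [← sum_mul, sum_gx_sub G hn]; ring

omit [LinearOrder K] [IsStrictOrderedRing K] in
/-- **Equal gaps: the block sum is itself a stochastic rounding.**  If every element of the block has
the same gap `g`, then `e(R) = g·Dₙ(R) = g·(⌊(Cₙ+R)/m⌋ − Cₙ/m)`: the rounded block sum is the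
`N`-bit SR (same draw) of the exact block sum, with the two-point law of `sum_fun_disc`. -/
theorem blockErr_const {m R : ℕ} (t : ℕ → ℕ) (hR : R < m) (g : K) (n : ℕ) :
    blockErr m t (fun _ => g) R n = g * disc K m t R n := by
  unfold blockErr
  rw [← mul_sum, sum_sysUp_sub_eq_disc t hR]

end Value

end Coupled

/-! ### A kernel-checked FP4 (E2M1) block -/

namespace FP4

open Coupled

/-- Residual numerators `t = (3,1,2,1)` (`θ = t/4`, `N = 2`) of the E2M1 block
`x = (11/2, 13/4, 5/2, 9/8)`, elements in order of non-increasing magnitude. -/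
def blkT : ℕ → ℕ
  | 0 => 3 | 1 => 1 | 2 => 2 | 3 => 1 | _ => 0

/-- Gaps `G = (2, 1, 1, 1/2)` of the cells `[4,6] ∋ 11/2`, `[3,4] ∋ 13/4`, `[2,3] ∋ 5/2`,
`[1,3/2] ∋ 9/8`. -/
def blkG : ℕ → ℚ
  | 0 => 2 | 1 => 1 | 2 => 1 | 3 => 1 / 2 | _ => 0

/-- The block data are consistent with E2M1: `dᵢ + θᵢGᵢ = xᵢ` with `dᵢ, dᵢ + Gᵢ` consecutive E2M1
values. -/
theorem blk_cells :
    (4 : ℚ) ∈ e2m1 ∧ (6 : ℚ) ∈ e2m1 ∧ (3 : ℚ) ∈ e2m1 ∧ (2 : ℚ) ∈ e2m1 ∧ (1 : ℚ) ∈ e2m1 ∧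
    (3 / 2 : ℚ) ∈ e2m1 ∧ (5 : ℚ) ∉ e2m1 ∧ (5 / 4 : ℚ) ∉ e2m1 ∧
    (4 : ℚ) + 3 / 4 * 2 = 11 / 2 ∧ (3 : ℚ) + 1 / 4 * 1 = 13 / 4 ∧ (2 : ℚ) + 2 / 4 * 1 = 5 / 2 ∧
    (1 : ℚ) + 1 / 4 * (1 / 2) = 9 / 8 := by
  refine ⟨by decide +kernel, by decide +kernel, by decide +kernel, by decide +kernel, by decide +kernel,
    by decide +kernel, by decide +kernel, by decide +kernel, by norm_num, by norm_num, by norm_num,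
    by norm_num⟩

/-- **Exact marginals** on the witness block: element `i` rounds up on exactly `tᵢ ∈ (3,1,2,1)` of the
four shared draws — each element alone is exactly `SR₂`. -/
theorem coupled_marginals : ∀ i < 4, ∑ R ∈ range 4, sysUp 4 blkT R i = blkT i := by decide

/-- **The rounding patterns** `(B₀,B₁,B₂,B₃)` for `R = 0,1,2,3`: `(0,1,0,0)`, `(1,0,0,1)`, `(1,0,1,0)`,
`(1,0,1,0)` — two shared random bits drive all four roundings. -/
theorem coupled_patterns :
    (∀ i < 4, sysUp 4 blkT 0 i = if i = 1 then 1 else 0) ∧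
    (∀ i < 4, sysUp 4 blkT 1 i = if i = 0 ∨ i = 3 then 1 else 0) ∧
    (∀ i < 4, sysUp 4 blkT 2 i = if i = 0 ∨ i = 2 then 1 else 0) ∧
    (∀ i < 4, sysUp 4 blkT 3 i = if i = 0 ∨ i = 2 then 1 else 0) := by decide

/-- **Block-sum errors** `e(R) ∈ {−11/8, 1/8, 5/8, 5/8}`: mean `0`; `E e² = 43/64 < 1 = G₀²/4`; the sure
bound `|e| ≤ (1 − 1/4)·2 = 3/2` holds with room (`11/8`). -/
theorem coupled_block_witness :
    (blockErr 4 blkT blkG 0 4 = -11 / 8 ∧ blockErr 4 blkT blkG 1 4 = 1 / 8 ∧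
      blockErr 4 blkT blkG 2 4 = 5 / 8 ∧ blockErr 4 blkT blkG 3 4 = 5 / 8) ∧
    ∑ R ∈ range 4, blockErr 4 blkT blkG R 4 = 0 ∧
    (∑ R ∈ range 4, blockErr 4 blkT blkG R 4 ^ 2) / 4 = 43 / 64 ∧
    (∀ R < 4, |blockErr 4 blkT blkG R 4| ≤ (1 - 1 / 4) * 2) := by
  have h : blockErr 4 blkT blkG 0 4 = -11 / 8 ∧ blockErr 4 blkT blkG 1 4 = 1 / 8 ∧
      blockErr 4 blkT blkG 2 4 = 5 / 8 ∧ blockErr 4 blkT blkG 3 4 = 5 / 8 := by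
    simp only [blockErr, sum_range_succ, sum_range_zero, sysUp, cnt, pre, blkT, blkG]
    norm_num
  obtain ⟨h0, h1, h2, h3⟩ := h
  refine ⟨⟨h0, h1, h2, h3⟩, ?_, ?_, ?_⟩
  · simp only [sum_range_succ, sum_range_zero, h0, h1, h2, h3]; norm_num
  · simp only [sum_range_succ, sum_range_zero, h0, h1, h2, h3]; norm_num
  · intro R hR
    interval_cases R
    · rw [h0]; norm_num [abs_of_nonpos]
    · rw [h1]; norm_num [abs_of_nonneg]
    · rw [h2]; norm_num [abs_of_nonneg]
    · rw [h3]; norm_num [abs_of_nonneg]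

/-- **Baselines on the same block** (plain arithmetic): independent `SR₂` has `E e² = ∑ Gᵢ²θᵢ(1−θᵢ)
= 79/64 > 43/64` and its errors fill `[−∑Gᵢθᵢ, ∑Gᵢ(1−θᵢ)] = [−19/8, 17/8]` (all down / all up, each
with positive probability), against `|e| ≤ 11/8` coupled; round-to-nearest commits the
DETERMINISTIC error `+1/2 − 1/4 ± 1/2 − 1/8`, i.e. `5/8` or `−3/8` by the tie at `5/2` — smaller than
`11/8` on this one block, but a bias, which adds up linearly over blocks where the coupled error
averages out (`sum_blockErr`). -/
theorem baselines_block :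
    (2 : ℚ) ^ 2 * (3 / 4) * (1 / 4) + 1 ^ 2 * (1 / 4) * (3 / 4) + 1 ^ 2 * (2 / 4) * (2 / 4)
        + (1 / 2) ^ 2 * (1 / 4) * (3 / 4) = 79 / 64 ∧
    -((2 : ℚ) * (3 / 4) + 1 * (1 / 4) + 1 * (2 / 4) + 1 / 2 * (1 / 4)) = -19 / 8 ∧
    (2 : ℚ) * (1 / 4) + 1 * (3 / 4) + 1 * (2 / 4) + 1 / 2 * (3 / 4) = 17 / 8 ∧
    (2 : ℚ) * (1 / 4) - 1 * (1 / 4) + 1 * (2 / 4) - 1 / 2 * (1 / 4) = 5 / 8 ∧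
    (2 : ℚ) * (1 / 4) - 1 * (1 / 4) - 1 * (2 / 4) - 1 / 2 * (1 / 4) = -3 / 8 := by
  norm_num

end FP4

end Summit.Ventures.CertifiedArithmetic.LowPrec.SR
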